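import Literature.AnabelianGeometry.SemiGraphs.PSCTwoComponentAffinePointedEdges
import HarnessLib

/-!
# [CombGC] Prop. 1.2 (i), edge-like case, at two-component data with one UNMARKED component

Mochizuki, *A combinatorial version of the Grothendieck conjecture* [CombGC] §1, Prop. 1.2 (i) p. 8
[cite: MochizukiCombGC2007, Prop 1.2(i) p.8].  PROOF-ONLY sequel (abc-iut-f-164 gen 2; row F-0459) to
`PSCTwoComponentAffinePointedEdges.lean`.  The data of TWO-COMPONENT AFFINE SHAPE (see
`PSCTwoComponentAffineShape.lean`: `C₀ ∪_ν C₁` glued at one node over a pro-`Σ` completion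
`ι : Γ_{g,r} → Π`; cusps `s ≤ j` on `C₀`, `j < s` on `C₁`; `Π_ν = closure ι⟨ε⟩`) are treated here in the
remaining case **`s = 0`: the component `C₁` carries NO marked point** (a closed curve of genus
`g − g₀ ≥ 1` by stability) and `C₀` carries all `r ≥ 1` of them (`2g₀ + r ≥ 2`).  Up to relabelling the two
blocks of handles this covers every pointed stable curve with two components, one node and at least one
marked point, one component unmarked — e.g. a one-pointed genus-2 curve degenerating to two elliptic curves
meeting at a node, the marked point on one of them.

## The argument

No cusp lies on `C₁`, so "node versus cusp `c_j`" (kill `c_j` but no power of `ε`) is never abelian: with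
a second marked point `c_k` it is the Heisenberg quotient with the active handle on `C₁` and `c_k ↦ Z⁻¹`
(`ε ↦ Z⁻¹`); with a single marked point BOTH a handle of `C₀` (`↦ (X, Y)`, commutator `Z`) and a handle
of `C₁` (`↦ (Y, X)`, commutator `Z⁻¹`) are active and every cusp `↦ 1`
(`PuncturedSurfaceGroup.exists_hom_two_handles`: the relator maps to `Z · Z⁻¹ = 1` because the commutators
are CENTRAL — the handle part of the relator is computed in the centre; centrality of `Z` in the Heisenberg
group is `Heisenberg.exists_heisenbergTriple_central`), so `ε ↦ Z`.  "Cusp versus node" is the two-cusp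
character `c_j ↦ 1, c_k ↦ −1` (`ε ↦ 0`) or, for a single marked point, the Heisenberg quotient
`(a_0, b_0) ↦ (X, Y)`, `c_j ↦ Z⁻¹` (`ε ↦ Z⁻¹Z = 1`); cusp versus cusp is malnormality.  Result:
`edgeLikeOpenInterDeterminesEdge_of_twoComponentUnmarked`.  Shape instances are consistency evidence for
the typed schema; nothing here takes a side on [IUTchIII] Cor. 3.12.
-/

noncomputable section

open Multiplicative

/-! ### The Heisenberg triple with centrality -/

namespace Literature.AnabelianGeometry.SemiGraphs.Heisenberg

open SemidirectProduct

/-- **A Heisenberg triple with central commutator**: in `H_q = (ℤ/q × ℤ/q) ⋊_φ ℤ/q` (`φ` the shear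
action of `exists_shearAction`) the elements `X = (0; 1)`, `Y = ((1,0); 0)`, `Z = ((0,1); 0)` satisfy
`X Y X⁻¹ Y⁻¹ = Z`, `Z` is CENTRAL, `Z^m = 1 ↔ q ∣ m`, and `|H_q| = q³`.
[cite: MochizukiSemiAnbd2006, Ex. 2.10 p.31] -/
theorem exists_heisenbergTriple_central (q : ℕ) :
    ∃ (φ : Multiplicative (ZMod q) →* MulAut (Multiplicative (ZMod q × ZMod q)))
      (X Y Z : Multiplicative (ZMod q × ZMod q) ⋊[φ] Multiplicative (ZMod q)),
      X * Y * X⁻¹ * Y⁻¹ = Z ∧ Z ∈ Subgroup.center (Multiplicative (ZMod q × ZMod q) ⋊[φ] Multiplicative (ZMod q)) ∧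
        (∀ m : ℕ, Z ^ m = 1 ↔ q ∣ m) ∧ Nat.card (Multiplicative (ZMod q × ZMod q) ⋊[φ] Multiplicative (ZMod q)) = q ^ 3 := by
  obtain ⟨φ, hφ⟩ := exists_shearAction q
  refine ⟨φ, inr (ofAdd 1), inl (ofAdd (1, 0)), inl (ofAdd (0, 1)), ?_, ?_, fun m => ?_, ?_⟩
  · have h1 : (inr (ofAdd (1 : ZMod q)) : Multiplicative (ZMod q × ZMod q) ⋊[φ] Multiplicative (ZMod q)) *
        inl (ofAdd (1, 0)) * (inr (ofAdd 1))⁻¹ = inl (ofAdd (1, 1)) := by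
      rw [← map_inv, ← inl_aut, hφ]
      simp
    rw [h1, ← map_inv, ← map_mul, inl_inj, ← ofAdd_neg, ← ofAdd_add]
    simp
  · refine Subgroup.mem_center_iff.mpr fun w => SemidirectProduct.ext ?_ ?_
    · rw [mul_left, mul_left, left_inl, right_inl, map_one, MulAut.one_apply, hφ, mul_comm]
      simp
    · rw [mul_right, mul_right, right_inl, mul_one, one_mul]
  · rw [← map_pow, ← (inl : _ →* Multiplicative (ZMod q × ZMod q) ⋊[φ] Multiplicative (ZMod q)).map_one, inl_inj,
      ← ofAdd_nsmul, ← ofAdd_zero, ofAdd.apply_eq_iff_eq, Prod.smul_mk, smul_zero, nsmul_eq_mul,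
      mul_one, Prod.mk_eq_zero, eq_self_iff_true, true_and, ZMod.natCast_eq_zero_iff]
  · rw [SemidirectProduct.card, Nat.card_congr (toAdd : Multiplicative (ZMod q × ZMod q) ≃ _),
      Nat.card_congr (toAdd : Multiplicative (ZMod q) ≃ _), Nat.card_prod, Nat.card_zmod]
    ring

end Literature.AnabelianGeometry.SemiGraphs.Heisenberg

/-! ### Homomorphisms of `Γ_{g,r}` with two active handles and central commutator -/

namespace Literature.GroupTheory.CombinatorialGroupTheory.PuncturedSurfaceGroup

variable {g r : ℕ}

/-- In a list without duplicates, a product whose factors are `1` except at one entry equals that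
factor. [folklore] -/
private theorem prod_map_finRange_single' {M : Type*} [Monoid M] {n : ℕ} (i₀ : Fin n) (F : Fin n → M)
    (hF : ∀ i, i ≠ i₀ → F i = 1) : ((List.finRange n).map F).prod = F i₀ := by
  rw [List.prod_map_eq_pow_single i₀ F (fun i hi _ => hF i hi),
    List.count_eq_one_of_mem (List.nodup_finRange n) (List.mem_finRange i₀), pow_one]

open scoped IsMulCommutative in
/-- **Homomorphisms `Γ_{g,r} → Q` with two active handles**: for `X, Y ∈ Q` whose commutator
`X Y X⁻¹ Y⁻¹` is CENTRAL and handles `i₁ ≠ i₂`, there is `ψ : Γ_{g,r} → Q` with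
`(a_{i₁}, b_{i₁}) ↦ (X, Y)`, `(a_{i₂}, b_{i₂}) ↦ (Y, X)` and every other generator `↦ 1` — the relator
maps to `[X,Y] · [Y,X] = 1` (the handle part is a product of central elements, computed in the commutative
group `Z(Q)`, Mathlib's scoped `IsMulCommutative` instances). [cite: MochizukiSemiAnbd2006, Ex. 2.10 p.31] -/
theorem exists_hom_two_handles {Q : Type*} [Group Q] (i₁ i₂ : Fin g) (h12 : i₁ ≠ i₂) (X Y : Q)
    (hZ : X * Y * X⁻¹ * Y⁻¹ ∈ Subgroup.center Q) :
    ∃ ψ : PuncturedSurfaceGroup g r →* Q, ψ (a i₁) = X ∧ ψ (b i₁) = Y ∧ ψ (a i₂) = Y ∧ ψ (b i₂) = X ∧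
      (∀ i, i ≠ i₁ → i ≠ i₂ → ψ (a i) = 1 ∧ ψ (b i) = 1) ∧ ∀ j, ψ (c j) = 1 := by
  classical
  have h21 : i₂ ≠ i₁ := fun h => h12 h.symm
  let f : puncturedSurfaceGen g r → Q :=
    Sum.elim (fun p => if p.1 = i₁ then (if p.2 then Y else X)
      else if p.1 = i₂ then (if p.2 then X else Y) else 1) fun _ => 1
  -- the handle commutators, as elements of the centre
  let F' : Fin g → Subgroup.center Q := fun i =>
    if i = i₁ then ⟨X * Y * X⁻¹ * Y⁻¹, hZ⟩ else if i = i₂ then ⟨X * Y * X⁻¹ * Y⁻¹, hZ⟩⁻¹ else 1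
  have hF : ∀ i : Fin g, f (Sum.inl (i, false)) * f (Sum.inl (i, true)) * (f (Sum.inl (i, false)))⁻¹ *
      (f (Sum.inl (i, true)))⁻¹ = ((F' i : Subgroup.center Q) : Q) := by
    intro i
    by_cases h1 : i = i₁
    · simp [f, F', h1]
    · by_cases h2 : i = i₂
      · simp [f, F', h2, h21, mul_assoc]
      · simp [f, F', h1, h2]
  have hrel : ∀ v ∈ ({relator g r} : Set (FreeGroup (puncturedSurfaceGen g r))),
      FreeGroup.lift f v = 1 := by
    intro v hv
    rw [Set.mem_singleton_iff] at hv
    subst hv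
    simp only [relator, map_mul, map_list_prod, List.map_map, Function.comp_def, map_inv, genA, genB,
      genC, FreeGroup.lift_apply_of]
    have h1 : ((List.finRange g).map fun i => f (Sum.inl (i, false)) * f (Sum.inl (i, true)) *
        (f (Sum.inl (i, false)))⁻¹ * (f (Sum.inl (i, true)))⁻¹).prod = 1 := by
      simp only [hF]
      rw [show (fun i => ((F' i : Subgroup.center Q) : Q)) = (Subgroup.center Q).subtype ∘ F' from rfl,
        ← List.map_map, ← map_list_prod, ← Fin.prod_univ_def F',
        Finset.prod_eq_mul i₁ i₂ h12 (fun i _ hi => by simp [F', hi.1, hi.2])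
          (fun h => absurd (Finset.mem_univ _) h) (fun h => absurd (Finset.mem_univ _) h)]
      simp [F', h21]
    have h2 : ((List.finRange r).map fun k => f (Sum.inr k)).prod = 1 :=
      List.prod_eq_one fun y hy => by
        obtain ⟨k, -, rfl⟩ := List.mem_map.mp hy
        rfl
    rw [h1, h2, one_mul]
  refine ⟨PresentedGroup.toGroup hrel, ?_, ?_, ?_, ?_, fun i hi1 hi2 => ⟨?_, ?_⟩, fun j => ?_⟩
  · rw [a, PresentedGroup.toGroup.of]; simp [f]
  · rw [b, PresentedGroup.toGroup.of]; simp [f]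
  · rw [a, PresentedGroup.toGroup.of]; simp [f, h21]
  · rw [b, PresentedGroup.toGroup.of]; simp [f, h21]
  · rw [a, PresentedGroup.toGroup.of]; simp [f, hi1, hi2]
  · rw [b, PresentedGroup.toGroup.of]; simp [f, hi1, hi2]
  · rw [c, PresentedGroup.toGroup.of]; rfl

/-- **Such a homomorphism on the node loop** `ε = (c_s ⋯ c_{r−1}) · ∏_{i<g₀}[a_i,b_i]` when
`i₁ < g₀ ≤ i₂`: `ψ(ε) = [X, Y]` (only the handle `i₁` of `C₀` contributes).
[cite: MochizukiCombGC2007, Prop 1.2(i) p.8] -/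
theorem hom_two_handles_nodeLoop {Q : Type*} [Group Q] {i₁ i₂ : Fin g} {X Y : Q}
    (ψ : PuncturedSurfaceGroup g r →* Q) (ha₁ : ψ (a i₁) = X) (hb₁ : ψ (b i₁) = Y)
    (hab : ∀ i, i ≠ i₁ → i ≠ i₂ → ψ (a i) = 1 ∧ ψ (b i) = 1) (hc : ∀ j, ψ (c j) = 1) (g₀ s : ℕ)
    (h₁ : (i₁ : ℕ) < g₀) (h₂ : g₀ ≤ (i₂ : ℕ)) :
    ψ (((List.finRange r).map fun j : Fin r => if s ≤ (j : ℕ) then c (g := g) j else 1).prod *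
        ((List.finRange g).map fun i : Fin g =>
          if (i : ℕ) < g₀ then a (r := r) i * b i * (a i)⁻¹ * (b i)⁻¹ else 1).prod) =
      X * Y * X⁻¹ * Y⁻¹ := by
  classical
  have hC : ψ ((List.finRange r).map fun j : Fin r =>
      if s ≤ (j : ℕ) then c (g := g) j else 1).prod = 1 := by
    rw [map_list_prod, List.map_map]
    exact List.prod_eq_one fun y hy => by
      obtain ⟨j, -, rfl⟩ := List.mem_map.mp hy
      simp only [Function.comp_apply, apply_ite ψ, map_one, hc, ite_self]
  have hA : ∀ i, i ≠ i₁ → (ψ ∘ fun i : Fin g =>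
      if (i : ℕ) < g₀ then a (r := r) i * b i * (a i)⁻¹ * (b i)⁻¹ else 1) i = 1 := by
    intro i hi
    by_cases hi2 : i = i₂
    · subst hi2
      simp only [Function.comp_apply, if_neg (not_lt.mpr h₂), map_one]
    · simp only [Function.comp_apply, apply_ite ψ, map_one, map_mul, map_inv, (hab i hi hi2).1,
        (hab i hi hi2).2, inv_one, mul_one, ite_self]
  rw [map_mul, hC, one_mul, map_list_prod, List.map_map, prod_map_finRange_single' i₁ _ hA]
  simp only [Function.comp_apply, if_pos h₁, map_mul, map_inv, ha₁, hb₁]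

end Literature.GroupTheory.CombinatorialGroupTheory.PuncturedSurfaceGroup


namespace Literature.AnabelianGeometry.SemiGraphs

open scoped Pointwise
open Literature.GroupTheory.CombinatorialGroupTheory
open SemiGraphOfAnabelioids (IsProSigmaCompletion)

universe u

namespace PSCDatum

open TwoComponentAffine

variable {P : Type u} [Group P] [TopologicalSpace P] [IsTopologicalGroup P]
variable [CompactSpace P] [T2Space P] [TotallyDisconnectedSpace P] {Sigma : Set ℕ} {g r : ℕ}

omit [CompactSpace P] [T2Space P] [TotallyDisconnectedSpace P] in
/-- A conjugate of a closed subgroup is closed (private copy of abc-iut-w5-d183's `isClosed_conj_smul`).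
[cite: MochizukiCombGC2007, Def 1.1(ii) p.6] -/
private theorem isClosed_conj_smul₃ {A : Subgroup P} (hA : IsClosed (A : Set P)) (γ : ConjAct P) :
    IsClosed ((γ • A : Subgroup P) : Set P) := by
  have h : ((γ • A : Subgroup P) : Set P) = (fun x : P => γ⁻¹ • x) ⁻¹' (A : Set P) := by
    ext x
    rw [SetLike.mem_coe, Subgroup.mem_pointwise_smul_iff_inv_smul_mem]
    rfl
  rw [h]
  refine hA.preimage ?_
  simp only [ConjAct.smul_def]
  fun_prop

omit [CompactSpace P] [T2Space P] [TotallyDisconnectedSpace P] in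
/-- A homomorphism with closed kernel killing `z ∈ Γ` kills `cl ι⟨z⟩`.
[cite: MochizukiCombGC2007, Prop 1.2(i) p.8] -/
private theorem map_zpowers_closure_le_ker_of_isClosed' {Γ : Type*} [Group Γ] (ι : Γ →* P)
    {Q : Type*} [Group Q] (Ψ : P →* Q) (hk : IsClosed (Ψ.ker : Set P)) (z : Γ) (hz : Ψ (ι z) = 1) :
    ((Subgroup.zpowers z).map ι).topologicalClosure ≤ Ψ.ker :=
  Subgroup.topologicalClosure_minimal _
    (Subgroup.map_le_iff_le_comap.mpr ((Subgroup.zpowers_le).mpr (by simpa using hz))) hk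

omit [T2Space P] in
/-- **The Heisenberg engine with centrality**: `γ₁ι(γ₀)γ₁⁻¹ ∈ S`, and for every `n` a homomorphism
`Γ_{g,r} → (ℤ/ℓⁿ × ℤ/ℓⁿ) ⋊ ℤ/ℓⁿ` sending `γ₀` to `Z^{±1}` (`Z` CENTRAL of order `ℓⁿ`) all of whose
closed-kernel extensions to `Π` kill `T` ⇒ `S ∩ T` is not open in `S`.
[cite: MochizukiCombGC2007, Prop 1.2(i) p.8] -/
private theorem not_isOpen_of_heisenberg_central {ι : PuncturedSurfaceGroup g r →* P}
    (hι : IsProSigmaCompletion Sigma ι) {ℓ : ℕ} (hℓ : ℓ.Prime) (hℓS : ℓ ∈ Sigma) {S T : Subgroup P}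
    (γ₁ : ConjAct P) (γ₀ : PuncturedSurfaceGroup g r) (hx : γ₁ • ι γ₀ ∈ S)
    (h : ∀ (n : ℕ) (φ : Multiplicative (ZMod (ℓ ^ n)) →* MulAut (Multiplicative (ZMod (ℓ ^ n) × ZMod (ℓ ^ n))))
      (X Y Z : Multiplicative (ZMod (ℓ ^ n) × ZMod (ℓ ^ n)) ⋊[φ] Multiplicative (ZMod (ℓ ^ n))), X * Y * X⁻¹ * Y⁻¹ = Z → Z ∈ Subgroup.center (Multiplicative (ZMod (ℓ ^ n) × ZMod (ℓ ^ n)) ⋊[φ] Multiplicative (ZMod (ℓ ^ n))) →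
      ∃ ψ : PuncturedSurfaceGroup g r →* Multiplicative (ZMod (ℓ ^ n) × ZMod (ℓ ^ n)) ⋊[φ] Multiplicative (ZMod (ℓ ^ n)), (ψ γ₀ = Z ∨ ψ γ₀ = Z⁻¹) ∧
        ∀ Ψ : P →* Multiplicative (ZMod (ℓ ^ n) × ZMod (ℓ ^ n)) ⋊[φ] Multiplicative (ZMod (ℓ ^ n)), IsClosed (Ψ.ker : Set P) → (∀ γ, Ψ (ι γ) = ψ γ) → T ≤ Ψ.ker) :
    ¬ IsOpen (((S ⊓ T).subgroupOf S : Subgroup S) : Set S) := by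
  intro hopen
  obtain ⟨n, hn, hxn⟩ := exists_pow_mem_of_isOpen_inf_subgroupOf hx hopen
  obtain ⟨φ, X, Y, Z, hXY, hZc, hZ, hcard⟩ := Heisenberg.exists_heisenbergTriple_central (ℓ ^ n)
  obtain ⟨ψ, hψ, hT⟩ := h n φ X Y Z hXY hZc
  letI : TopologicalSpace (Multiplicative (ZMod (ℓ ^ n) × ZMod (ℓ ^ n)) ⋊[φ] Multiplicative (ZMod (ℓ ^ n))) := ⊥
  haveI : DiscreteTopology (Multiplicative (ZMod (ℓ ^ n) × ZMod (ℓ ^ n)) ⋊[φ] Multiplicative (ZMod (ℓ ^ n))) := ⟨rfl⟩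
  haveI : Finite (Multiplicative (ZMod (ℓ ^ n) × ZMod (ℓ ^ n)) ⋊[φ] Multiplicative (ZMod (ℓ ^ n))) :=
    Nat.finite_of_card_ne_zero (by rw [hcard]; exact pow_ne_zero _ (pow_ne_zero _ hℓ.ne_zero))
  obtain ⟨Ψ, hΨc, hΨ⟩ := hι.exists_continuous_extend_of_card_primePow hℓ hℓS (k := n * 3)
    (by rw [hcard, pow_mul]) ψ
  have hk : IsClosed (Ψ.ker : Set P) := by
    rw [MonoidHom.coe_ker]
    exact (isClosed_discrete _).preimage hΨc
  have h1 : Ψ ((γ₁ • ι γ₀) ^ n) = 1 := hT Ψ hk hΨ hxn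
  rw [map_pow, ConjAct.smul_def, map_mul, map_mul, map_inv, conj_pow, conj_eq_one_iff, hΨ] at h1
  have hdvd : ℓ ^ n ∣ n := by
    rcases hψ with hψ | hψ
    · exact (hZ n).mp (hψ ▸ h1)
    · rw [hψ, inv_pow, inv_eq_one] at h1
      exact (hZ n).mp h1
  exact absurd (Nat.le_of_dvd hn hdvd) (not_le.mpr (Nat.lt_pow_self hℓ.one_lt))

/-- **[CombGC] Prop. 1.2 (i), edge-like case, at two-component affine shape with `C₁` unmarked**
(`s = 0`; `C₀` stable with all `r ≥ 1` marked points, `C₁` of genus `≥ 1`).  Pairs: node/node — one node;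
cusp/cusp — malnormality of cusp inertia; cusp/node — the two-cusp character, or (one marked point) the
Heisenberg quotient `(a_0,b_0) ↦ (X,Y)`, `c ↦ Z⁻¹`; node/cusp — the Heisenberg quotient with the active
handle on `C₁` and a second cusp `↦ Z⁻¹`, or (one marked point) with BOTH handles `0 ↦ (X,Y)` and
`g₀ ↦ (Y,X)` active and every cusp `↦ 1`. [cite: MochizukiCombGC2007, Prop 1.2(i) p.8] -/
theorem edgeLikeOpenInterDeterminesEdge_of_twoComponentUnmarked (hne : Sigma.Nonempty)
    (hprime : ∀ p ∈ Sigma, p.Prime) (ι : PuncturedSurfaceGroup g r →* P)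
    (hι : IsProSigmaCompletion Sigma ι) (G : PSCDatum P) {g₀ s : ℕ} (hg₀ : g₀ ≤ g) (hs : s = 0)
    (hr : 1 ≤ r) (hst₀ : 1 ≤ g₀ ∨ 2 ≤ r) (hg₁ : 1 ≤ g - g₀)
    (e : G.graph.C ≃ Fin r)
    (hC : ∀ c, G.cuspGp c =
      ((PuncturedSurfaceGroup.cuspInertia (g := g) (e c)).map ι).topologicalClosure)
    (ε : PuncturedSurfaceGroup g r)
    (hε : ε = ((List.finRange r).map fun j : Fin r =>
          if s ≤ (j : ℕ) then PuncturedSurfaceGroup.c (g := g) j else 1).prod *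
        ((List.finRange g).map fun i : Fin g => if (i : ℕ) < g₀ then
          PuncturedSurfaceGroup.a (r := r) i * PuncturedSurfaceGroup.b i *
            (PuncturedSurfaceGroup.a i)⁻¹ * (PuncturedSurfaceGroup.b i)⁻¹ else 1).prod)
    (n₀ : G.graph.N) (hN : ∀ n, n = n₀)
    (hE : G.nodeGp n₀ = ((Subgroup.zpowers ε).map ι).topologicalClosure) :
    G.EdgeLikeOpenInterDeterminesEdge := by
  classical
  subst hs
  have hne' := hne
  obtain ⟨ℓ, hℓS⟩ := hne
  have hℓ : ℓ.Prime := hprime ℓ hℓS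
  have hhyp : PuncturedSurfaceGroup.IsHyperbolicType g r := by
    unfold PuncturedSurfaceGroup.IsHyperbolicType; omega
  intro e₁ e₂ γ₁ γ₂ hopen
  by_contra hne12
  rcases e₁ with n₁ | c₁ <;> rcases e₂ with n₂ | c₂
  · exact hne12 (by rw [hN n₁, hN n₂])
  · -- node vs cusp `j = e c₂`: never abelian (no marked point on `C₁`)
    refine not_isOpen_of_heisenberg_central hι hℓ hℓS (S := γ₁ • G.edgeGp (Sum.inl n₁))
      (T := γ₂ • G.edgeGp (Sum.inr c₂)) γ₁ ε ?_ (fun n φ X Y Z hXY hZc => ?_) hopen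
    · change γ₁ • ι ε ∈ γ₁ • G.nodeGp n₁
      rw [hN n₁, hE]
      exact Subgroup.smul_mem_pointwise_smul _ _ _ (Subgroup.le_topologicalClosure _
        (Subgroup.mem_map_of_mem ι (Subgroup.mem_zpowers ε)))
    · by_cases hk : ∃ k : Fin r, k ≠ e c₂
      · -- a second marked point `c_k ↦ Z⁻¹`, active handle `g₀` on `C₁`
        obtain ⟨k, hkj⟩ := hk
        have hrel : X * Y * X⁻¹ * Y⁻¹ * Z⁻¹ = 1 := by rw [hXY, mul_inv_cancel]
        obtain ⟨ψ, ha, hb, hc, hab', hc'⟩ := PuncturedSurfaceGroup.exists_hom_handle_cusp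
          (g := g) (r := r) ⟨g₀, by omega⟩ k X Y Z⁻¹ hrel
        refine ⟨ψ, Or.inr ?_, fun Ψ hΨc hΨ => ?_⟩
        · rw [hε, PuncturedSurfaceGroup.hom_handle_cusp_nodeLoop ψ ha hb hc hab' hc' g₀ 0,
            if_pos (Nat.zero_le _), if_neg (by simp), mul_one]
        · change γ₂ • G.cuspGp c₂ ≤ Ψ.ker
          rw [hC, PuncturedSurfaceGroup.cuspInertia]
          refine smul_le_ker_of_le_ker (map_zpowers_closure_le_ker_of_isClosed' ι Ψ hΨc _ ?_) γ₂
          rw [hΨ, hc' _ hkj.symm]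
      · -- a single marked point: both handles `0` and `g₀` active, every cusp `↦ 1`
        have hg : 1 ≤ g₀ := by
          rcases hst₀ with h | h
          · exact h
          · exfalso
            refine hk ?_
            by_cases h0 : ((e c₂ : Fin r) : ℕ) = 0
            · exact ⟨⟨1, by omega⟩, fun h' => absurd (congrArg Fin.val h') (by simp; omega)⟩
            · exact ⟨⟨0, by omega⟩, fun h' => absurd (congrArg Fin.val h') (by simp; omega)⟩
        obtain ⟨ψ, ha₁, hb₁, -, -, hab', hc'⟩ := PuncturedSurfaceGroup.exists_hom_two_handles
          (g := g) (r := r) ⟨0, by omega⟩ ⟨g₀, by omega⟩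
          (fun h' => absurd (congrArg Fin.val h') (by simp; omega)) X Y (hXY ▸ hZc)
        refine ⟨ψ, Or.inl ?_, fun Ψ hΨc hΨ => ?_⟩
        · rw [hε, PuncturedSurfaceGroup.hom_two_handles_nodeLoop ψ ha₁ hb₁ hab' hc' g₀ 0
            (by change 0 < g₀; omega) (by change g₀ ≤ g₀; exact le_rfl), hXY]
        · change γ₂ • G.cuspGp c₂ ≤ Ψ.ker
          rw [hC, PuncturedSurfaceGroup.cuspInertia]
          refine smul_le_ker_of_le_ker (map_zpowers_closure_le_ker_of_isClosed' ι Ψ hΨc _ ?_) γ₂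
          rw [hΨ, hc']
  · -- cusp `j = e c₁` vs node
    by_cases hk : ∃ k : Fin r, k ≠ e c₁
    · -- abelian: `δ_j − δ_k`; the node loop has weight `1 − 1 = 0`
      obtain ⟨k, hkj⟩ := hk
      have hopen' := hopen
      change IsOpen ((((γ₁ • G.cuspGp c₁) ⊓ γ₂ • G.nodeGp n₂).subgroupOf (γ₁ • G.cuspGp c₁) :
        Subgroup (γ₁ • G.cuspGp c₁ : Subgroup P)) : Set (γ₁ • G.cuspGp c₁ : Subgroup P)) at hopen'
      rw [hN n₂, hE, hC, PuncturedSurfaceGroup.cuspInertia] at hopen'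
      refine not_isOpen_inf_subgroupOf_of_characters hℓ.one_lt _ _
        (x := γ₁ • ι (PuncturedSurfaceGroup.c (e c₁)))
        (Subgroup.smul_mem_pointwise_smul _ _ _ (Subgroup.le_topologicalClosure _
          (Subgroup.mem_map_of_mem ι (Subgroup.mem_zpowers _)))) (fun n => ?_) hopen'
      let wc : Fin r → ZMod (ℓ ^ n) := fun l =>
        (if l = e c₁ then 1 else 0) + (if l = k then -1 else 0)
      obtain ⟨φ, -, -, hφc⟩ :=
        PuncturedSurfaceGroup.exists_handleCuspCharacter (g := g) 0 0 wc (sum_twoDelta (e c₁) k)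
      obtain ⟨χ, hχc, hχ⟩ := exists_continuous_extend_zmod_pow hι hℓ hℓS n φ
      refine ⟨χ, smul_le_ker_of_le_ker (topologicalClosure_map_zpowers_le_ker ι χ hχc _ ?_) γ₂,
        by rw [map_conjAct_smul_eq_self, hχ, hφc]; simp [wc, hkj.symm]⟩
      rw [hχ, hε, character_nodeLoop φ hφc, sum_ite_twoDelta, if_pos (Nat.zero_le _),
        if_pos (Nat.zero_le _)]
      simp
    · -- a single marked point: Heisenberg `(a_0,b_0) ↦ (X,Y)`, `c_j ↦ Z⁻¹`, so `ε ↦ Z⁻¹ Z = 1`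
      have hg : 1 ≤ g₀ := by
        rcases hst₀ with h | h
        · exact h
        · exfalso
          refine hk ?_
          by_cases h0 : ((e c₁ : Fin r) : ℕ) = 0
          · exact ⟨⟨1, by omega⟩, fun h' => absurd (congrArg Fin.val h') (by simp; omega)⟩
          · exact ⟨⟨0, by omega⟩, fun h' => absurd (congrArg Fin.val h') (by simp; omega)⟩
      refine not_isOpen_of_heisenberg_central hι hℓ hℓS (S := γ₁ • G.edgeGp (Sum.inr c₁))
        (T := γ₂ • G.edgeGp (Sum.inl n₂)) γ₁ (PuncturedSurfaceGroup.c (e c₁)) ?_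
        (fun n φ X Y Z hXY hZc => ?_) hopen
      · change γ₁ • ι (PuncturedSurfaceGroup.c (e c₁)) ∈ γ₁ • G.cuspGp c₁
        rw [hC]
        exact Subgroup.smul_mem_pointwise_smul _ _ _ (Subgroup.le_topologicalClosure _
          (Subgroup.mem_map_of_mem ι (Subgroup.mem_zpowers _)))
      · have hrel : X * Y * X⁻¹ * Y⁻¹ * Z⁻¹ = 1 := by rw [hXY, mul_inv_cancel]
        obtain ⟨ψ, ha, hb, hc, hab', hc'⟩ := PuncturedSurfaceGroup.exists_hom_handle_cusp
          (g := g) (r := r) ⟨0, by omega⟩ (e c₁) X Y Z⁻¹ hrel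
        refine ⟨ψ, Or.inr hc, fun Ψ hΨc hΨ => ?_⟩
        change γ₂ • G.nodeGp n₂ ≤ Ψ.ker
        rw [hN n₂, hE]
        refine smul_le_ker_of_le_ker (map_zpowers_closure_le_ker_of_isClosed' ι Ψ hΨc _ ?_) γ₂
        rw [hΨ, hε, PuncturedSurfaceGroup.hom_handle_cusp_nodeLoop ψ ha hb hc hab' hc' g₀ 0,
          if_pos (Nat.zero_le _), if_pos (by change 0 < g₀; omega), ← hXY, inv_mul_cancel]
  · -- cusp vs cusp: malnormality of cusp inertia
    by_cases hc : c₁ = c₂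
    · exact hne12 (by rw [hc])
    have hopen' := hopen
    change IsOpen ((((γ₁ • G.cuspGp c₁) ⊓ (γ₂ • G.cuspGp c₂)).subgroupOf (γ₁ • G.cuspGp c₁) :
      Subgroup (γ₁ • G.cuspGp c₁ : Subgroup P)) : Set (γ₁ • G.cuspGp c₁ : Subgroup P)) at hopen'
    rw [G.smul_cuspGp_inf_smul_cuspGp_eq_bot hne' hprime hhyp ι hι e hC hc, Subgroup.bot_subgroupOf,
      Subgroup.coe_bot] at hopen'
    haveI : DiscreteTopology (γ₁ • G.cuspGp c₁ : Subgroup P) :=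
      discreteTopology_iff_isOpen_singleton_one.mpr hopen'
    haveI : CompactSpace (γ₁ • G.cuspGp c₁ : Subgroup P) :=
      isCompact_iff_compactSpace.mp (isClosed_conj_smul₃ (G.isClosed_cuspGp c₁) γ₁).isCompact
    haveI := G.infinite_cuspGp hne' hprime hhyp ι hι e hC c₁
    haveI : Infinite (γ₁ • G.cuspGp c₁ : Subgroup P) :=
      Infinite.of_injective _ (Subgroup.equivSMul γ₁ (G.cuspGp c₁)).injective
    exact (‹Infinite (γ₁ • G.cuspGp c₁ : Subgroup P)›).not_finite finite_of_compact_of_discrete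

end PSCDatum

end Literature.AnabelianGeometry.SemiGraphs

end
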